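import Summits.Parity.GeneralizedHardyLittlewood.Theorems.LiouvilleShiftedTablesTypeI2DilatedURB3
import Summits.Parity.GeneralizedHardyLittlewood.Theorems.LiouvilleShiftedTablesTypeI2DilatedURB4

/-!
# The `𝔲_R` terms of the assembly (`stub_uRBound`), file 5: Type II

Route `LiouvilleShiftedTables` (Parity / GeneralizedHardyLittlewood), crux `TypeI2Dilated` (stmt-Parity-14272), line
`peel-to-drappeau`, registered stub `stub_uRBound : URBound`; continuation of `…URB1`–`…URB4`.

**Type II** (`urb_typeII`).  Let `F_{j,κ}` (`1 ≤ j ≤ 4`) be a box piece whose scales `V_i = boxScale x κ_i` satisfy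
`x^{1−ρ₀'} ≤ ∏_i V_i ≤ 2x` and, for some set `S` of slots, `x^{1/50} ≤ ∏_{i∈S} V_i ≤ x^{1/3−1/50}`.  Then
`NS(F_{j,κ}) ≤ x^{1−6ρ}` for `60ρ ≤ ρ₀' = min(ρ₀(c, 1/100), 1/100)` and `x ≥ x₀(ρ)`, where `ρ₀(c, η)` is the exponent
of the hypothesis `DilatedTypeII` (Drappeau's Theorem 5.1 in crux coordinates).  Proof: `F = α ⋆ β` with
`α = ∏_{i ∉ S} slot_i` supported in `(A, 2^a A]`, `β = ∏_{i ∈ S} slot_i` supported in `(B, 2^b B]` (`a + b = 2j ≤ 8`,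
values `≤ τ^8`); by `normSum_conv_le`, `NS(F)` is at most the sum over the `ab ≤ 16` dyadic pairs
`(M, N) = (2^i A, 2^{i'} B)` of the `(q, r)`-sums of `DilatedTypeII` at `(η, ρ', K) = (1/100, 4ρ, 8)`, classes `u ≡ c`,
`v ≡ w + c`, window `(0, Y]`, `R' = RP` (re-indexing `r ↦ rP`, `sum_sum_le_dilate`), `Rd = x^{40ρ}`; the side
conditions `x^{1/100} ≤ N ≤ x^{1/3−1/100}`, `x^{1−ρ₀} ≤ MN ≤ 256x`, `RP ≤ x^{4ρ}`, `x^{1/2−ρ₀} ≤ Slo`,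
`2 Slo R P ≤ x^{1/2+4ρ}`, `1 ≤ Rd ≤ x^{ρ₀}` hold, and each pair contributes `≤ C x^{1+20ρ}/x^{40ρ} = C x^{1−20ρ}`.
[this line: Lines/peel-to-drappeau.md; cite: Drappeau2017, Thm 5.1, §6]
-/

noncomputable section

namespace Summit.Parity.GeneralizedHardyLittlewood.Cruxes.TypeI2Dilated.PeelToDrappeau

open Finset Fintype Real Filter
open scoped ArithmeticFunction.sigma Classical
open Literature.NumberTheory.Sieve Literature.NumberTheory.Sieve.Drappeau2017

/-- `∏_{i ∈ S} (2 V_i) = 2^{#S} ∏_{i ∈ S} V_i`. [folklore] -/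
theorem prod_two_mul {ι : Type*} (S : Finset ι) (V : ι → ℝ) : ∏ i ∈ S, (2 * V i) = 2 ^ S.card * ∏ i ∈ S, V i := by
  rw [Finset.prod_mul_distrib, Finset.prod_const]

/-- The complex lift of a real sequence bounded by `τ^8` is bounded by `τ^K`, `K = 8`. [folklore] -/
theorem norm_ofReal_le_sigma_rpow {a : ℕ → ℝ} (ha : ∀ m, |a m| ≤ (σ 0 m : ℝ) ^ 8) (m : ℕ) :
    ‖((a m : ℝ) : ℂ)‖ ≤ (σ 0 m : ℝ) ^ (8 : ℝ) := by
  rw [Complex.norm_real, Real.norm_eq_abs, show (8 : ℝ) = ((8 : ℕ) : ℝ) by norm_num, Real.rpow_natCast]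
  exact ha m

/-- **Type II.** See the module docstring. [this line; cite: Drappeau2017, Thm 5.1] -/
theorem urb_typeII (hDT : DilatedTypeII) {c : ℤ} (hc : c ≠ 0) :
    ∃ ρ₀ : ℝ, 0 < ρ₀ ∧ ρ₀ ≤ 1 / 100 ∧ ∀ ρ : ℝ, 0 < ρ → 60 * ρ ≤ ρ₀ → ∃ x₀ : ℝ, ∀ x : ℝ, x₀ ≤ x →
      ∀ w : ℕ, ∀ Y R Slo : ℝ, ∀ P : ℕ, 1 ≤ P → Y ≤ 2 * x → 1 ≤ R → (P : ℝ) * R ≤ x ^ (4 * ρ) →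
        x ^ (1 / 2 - 9 * ρ) ≤ Slo → 2 * Slo * R * P ≤ x ^ (1 / 2 + ρ) →
      ∀ j ∈ Icc 1 4, ∀ κ : Fin (2 * j) → ℕ, ∀ S : Finset (Fin (2 * j)),
        x ^ (1 - ρ₀) ≤ ∏ i, boxScale x (κ i) → (∏ i, boxScale x (κ i)) ≤ 2 * x →
        x ^ (1 / 50 : ℝ) ≤ ∏ i ∈ S, boxScale x (κ i) → (∏ i ∈ S, boxScale x (κ i)) ≤ x ^ (1 / 3 - 1 / 50 : ℝ) →
        normSum c w P x ρ Y R Slo (fun m => hbBox x ρ j κ m) ≤ x ^ (1 - 6 * ρ) := by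
  obtain ⟨ρ₀, hρ₀, hmain⟩ := hDT c hc (1 / 100) (by norm_num) (by norm_num)
  refine ⟨min ρ₀ (1 / 100), lt_min hρ₀ (by norm_num), min_le_right _ _, fun ρ hρ h60 => ?_⟩
  have hρρ₀ : 60 * ρ ≤ ρ₀ := h60.trans (min_le_left _ _)
  have hρ100 : 60 * ρ ≤ 1 / 100 := h60.trans (min_le_right _ _)
  obtain ⟨C, x₁, hC⟩ := hmain (4 * ρ) (by linarith) (by linarith) 8 (by norm_num)
  have hev : ∀ᶠ x : ℝ in atTop, 16 * max C 0 ≤ x ^ (14 * ρ) ∧ (2 : ℝ) ^ 7 ≤ x ^ (1 / 100 : ℝ) ∧ (1 : ℝ) ≤ x :=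
    (eventually_le_rpow _ (by linarith)).and ((eventually_le_rpow _ (by norm_num)).and (eventually_ge_atTop _))
  obtain ⟨x₂, hx₂⟩ := Filter.eventually_atTop.1 hev
  refine ⟨max x₁ x₂, fun x hx w Y R Slo P hP hY hR hPR hSlo hSRP j hj κ S hP1 hP2 hS1 hS2 => ?_⟩
  obtain ⟨e1, e2, hx1⟩ := hx₂ x ((le_max_right _ _).trans hx)
  have hxx₁ : x₁ ≤ x := (le_max_left _ _).trans hx
  have hx0 : 0 < x := by linarith
  rw [Finset.mem_Icc] at hj
  -- the scales; `S` and `Sᶜ` are nonempty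
  set V : Fin (2 * j) → ℝ := fun i => boxScale x (κ i) with hV
  have hV0 : ∀ i, 0 < V i := fun i => boxScale_pos hx0 _
  have hx100 : x ^ (1 / 100 : ℝ) ≤ x := by
    calc x ^ (1 / 100 : ℝ) ≤ x ^ (1 : ℝ) := Real.rpow_le_rpow_of_exponent_le hx1 (by norm_num)
      _ = x := Real.rpow_one x
  have hxgt : 1 < x := by
    have h27 : (2 : ℝ) ≤ 2 ^ 7 := by norm_num
    linarith
  have hSne : S.Nonempty := by
    rw [Finset.nonempty_iff_ne_empty]
    rintro rfl
    rw [Finset.prod_empty] at hS1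
    have : (1 : ℝ) < x ^ (1 / 50 : ℝ) := Real.one_lt_rpow hxgt (by norm_num)
    linarith
  have hScne : Sᶜ.Nonempty := by
    rw [Finset.nonempty_iff_ne_empty, Ne, Finset.compl_eq_empty_iff]
    rintro rfl
    have h1 : x ^ (1 - min ρ₀ (1 / 100)) ≤ x ^ (1 / 3 - 1 / 50 : ℝ) := hP1.trans hS2
    have h2 : x ^ (1 / 3 - 1 / 50 : ℝ) < x ^ (1 - min ρ₀ (1 / 100)) :=
      Real.rpow_lt_rpow_of_exponent_lt hxgt (by have := min_le_right ρ₀ (1 / 100 : ℝ); linarith)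
    linarith
  -- the two factors
  set A : ℝ := ∏ i ∈ Sᶜ, V i with hA
  set B : ℝ := ∏ i ∈ S, V i with hB
  have hA0 : 0 < A := Finset.prod_pos fun i _ => hV0 i
  have hB0 : 0 < B := Finset.prod_pos fun i _ => hV0 i
  have hAB : A * B = ∏ i, V i := Finset.prod_compl_mul_prod S V
  set α : ArithmeticFunction ℝ := ∏ i ∈ Sᶜ, hbSlot x ρ j κ i with hα
  set β : ArithmeticFunction ℝ := ∏ i ∈ S, hbSlot x ρ j κ i with hβ
  have hαβ : hbBox x ρ j κ = α * β := (Finset.prod_compl_mul_prod S _).symm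
  -- supports and sizes
  have hαsupp : ∀ m, α m ≠ 0 → A < m ∧ (m : ℝ) ≤ 2 ^ Sᶜ.card * A := by
    intro m hm
    obtain ⟨h1, h2⟩ := prod_hbSlot_ne_zero_bounds hx0 ρ κ hScne hm
    exact ⟨h1, h2.trans (le_of_eq (prod_two_mul _ _))⟩
  have hβsupp : ∀ n, β n ≠ 0 → B < n ∧ (n : ℝ) ≤ 2 ^ S.card * B := by
    intro n hn
    obtain ⟨h1, h2⟩ := prod_hbSlot_ne_zero_bounds hx0 ρ κ hSne hn
    exact ⟨h1, h2.trans (le_of_eq (prod_two_mul _ _))⟩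
  have hcard : Sᶜ.card + S.card = 2 * j := by
    rw [Finset.card_compl, Fintype.card_fin]
    have := S.card_le_univ
    rw [Fintype.card_fin] at this
    omega
  have hαle : ∀ m, |α m| ≤ (σ 0 m : ℝ) ^ 8 := fun m => abs_prod_hbSlot_le_pow_eight x ρ κ (by omega) m
  have hβle : ∀ n, |β n| ≤ (σ 0 n : ℝ) ^ 8 := fun n => abs_prod_hbSlot_le_pow_eight x ρ κ (by omega) n
  -- the expansion
  have hexp := normSum_conv_le α β hA0 hB0 Sᶜ.card S.card hαsupp hβsupp c w P x ρ Y R Slo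
  rw [show (fun m => hbBox x ρ j κ m) = (fun m => (α * β) m) from funext fun m => by rw [hαβ]]
  refine hexp.trans ?_
  -- each dyadic pair is an instance of `DilatedTypeII`
  have hR0 : 0 ≤ R := by linarith
  have hpair : ∀ i ∈ Finset.range Sᶜ.card, ∀ i' ∈ Finset.range S.card,
      ∑ q ∈ Icc 1 ⌊x ^ ρ⌋₊, ∑ r ∈ Icc 1 ⌊R⌋₊,
        ‖∑ s ∈ sRange c q (r * P) Slo (2 * Slo), ∑ m ∈ BFI.dyadic (2 ^ i * A), ∑ n ∈ BFI.dyadic (2 ^ i' * B),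
          (if m * n ∈ classFilter c q w (r * P) Y then
            ((α m : ℝ) : ℂ) * ((β n : ℝ) : ℂ) * uR (x ^ (40 * ρ)) s (((m * n : ℕ) : ZMod s) * ((c : ZMod s))⁻¹)
            else 0)‖ ≤ max C 0 * x ^ (1 - 20 * ρ) := by
    intro i hi i' hi'
    rw [Finset.mem_range] at hi hi'
    set M : ℝ := 2 ^ i * A with hM
    set N : ℝ := 2 ^ i' * B with hN
    -- ranges of `M`, `N`
    have h2i : (1 : ℝ) ≤ 2 ^ i := one_le_pow₀ (by norm_num)
    have h2i' : (1 : ℝ) ≤ 2 ^ i' := one_le_pow₀ (by norm_num)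
    have hN1 : x ^ (1 / 100 : ℝ) ≤ N := by
      have h1 : x ^ (1 / 100 : ℝ) ≤ x ^ (1 / 50 : ℝ) := Real.rpow_le_rpow_of_exponent_le hx1 (by norm_num)
      have h2 : B ≤ N := by rw [hN]; exact le_mul_of_one_le_left hB0.le h2i'
      linarith
    have hN2 : N ≤ x ^ (1 / 3 - 1 / 100 : ℝ) := by
      have h1 : (2 : ℝ) ^ i' ≤ 2 ^ 7 := pow_le_pow_right₀ (by norm_num) (by omega)
      calc N ≤ 2 ^ 7 * x ^ (1 / 3 - 1 / 50 : ℝ) := by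
            rw [hN]; exact mul_le_mul h1 hS2 hB0.le (by positivity)
        _ ≤ x ^ (1 / 100 : ℝ) * x ^ (1 / 3 - 1 / 50 : ℝ) :=
            mul_le_mul_of_nonneg_right e2 (Real.rpow_nonneg hx0.le _)
        _ = x ^ (1 / 3 - 1 / 100 : ℝ) := by rw [← Real.rpow_add hx0]; norm_num
    have hMN1 : x ^ (1 - ρ₀) ≤ M * N := by
      have h1 : x ^ (1 - ρ₀) ≤ x ^ (1 - min ρ₀ (1 / 100)) :=
        Real.rpow_le_rpow_of_exponent_le hx1 (by have := min_le_left ρ₀ (1 / 100 : ℝ); linarith)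
      have h2 : A * B ≤ M * N := by
        rw [hM, hN]
        calc A * B = 1 * A * (1 * B) := by ring
          _ ≤ 2 ^ i * A * (2 ^ i' * B) := by gcongr
      rw [hAB] at h2
      linarith
    have hMN2 : M * N ≤ 256 * x := by
      have hii' : i + i' ≤ 6 := by omega
      have h1 : (2 : ℝ) ^ (i + i') ≤ 2 ^ 6 := pow_le_pow_right₀ (by norm_num) hii'
      calc M * N = 2 ^ (i + i') * (A * B) := by rw [hM, hN, pow_add]; ring
        _ ≤ 2 ^ 6 * (2 * x) := by rw [hAB]; exact mul_le_mul h1 hP2 (by rw [← hAB]; positivity) (by positivity)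
        _ ≤ 256 * x := by linarith
    -- the remaining side conditions
    have hR' : R * P ≤ x ^ (4 * ρ) := by rw [mul_comm]; exact hPR
    have hSlo' : x ^ (1 / 2 - ρ₀) ≤ Slo :=
      (Real.rpow_le_rpow_of_exponent_le hx1 (by linarith)).trans hSlo
    have hSR' : 2 * Slo * (R * P) ≤ x ^ (1 / 2 + 4 * ρ) := by
      rw [← mul_assoc]
      exact hSRP.trans (Real.rpow_le_rpow_of_exponent_le hx1 (by linarith))
    have hRd1 : 1 ≤ x ^ (40 * ρ) := Real.one_le_rpow hx1 (by linarith)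
    have hRd2 : x ^ (40 * ρ) ≤ x ^ ρ₀ := Real.rpow_le_rpow_of_exponent_le hx1 (by linarith)
    have key := hC x hxx₁ M N hN1 hN2 hMN1 hMN2 (fun m => ((α m : ℝ) : ℂ)) (fun n => ((β n : ℝ) : ℂ))
      (norm_ofReal_le_sigma_rpow hαle) (norm_ofReal_le_sigma_rpow hβle) (fun _ => c) (fun _ => (w : ℤ) + c)
      0 Y (R * P) Slo (x ^ (40 * ρ)) hR' hSlo' hSR' hRd1 hRd2
    -- compare with our sum: re-index `r ↦ rP`, enlarge the `q`-range, and identify the summands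
    have hsummand : ∀ q r' : ℕ, ∀ s ∈ sRange c q r' Slo (2 * Slo), ∀ m n : ℕ,
        (if m * n ∈ classFilter c q w r' Y then
          ((α m : ℝ) : ℂ) * ((β n : ℝ) : ℂ) * uR (x ^ (40 * ρ)) s (((m * n : ℕ) : ZMod s) * ((c : ZMod s))⁻¹)
          else 0) =
        (if (0 : ℝ) < ((m * n : ℕ) : ℝ) ∧ ((m * n : ℕ) : ℝ) ≤ Y ∧
            ((m * n : ℕ) : ZMod r') = (((fun _ => c) r' : ℤ) : ZMod r') ∧
            ((m * n : ℕ) : ZMod q) = (((fun _ => (w : ℤ) + c) q : ℤ) : ZMod q) then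
          ((α m : ℝ) : ℂ) * ((β n : ℝ) : ℂ) * uR (x ^ (40 * ρ)) s (((m * n : ℕ) : ZMod s) * ((c : ZMod s))⁻¹)
          else 0) := fun q r' s _ m n => if_congr (mem_classFilter_iff' c q w r' Y (m * n)) rfl rfl
    calc _ ≤ ∑ q ∈ Icc 1 ⌊x ^ (4 * ρ)⌋₊, ∑ r' ∈ Icc 1 ⌊R * P⌋₊,
          ‖∑ s ∈ sRange c q r' Slo (2 * Slo), ∑ m ∈ BFI.dyadic M, ∑ n ∈ BFI.dyadic N,
            (if m * n ∈ classFilter c q w r' Y then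
              ((α m : ℝ) : ℂ) * ((β n : ℝ) : ℂ) * uR (x ^ (40 * ρ)) s (((m * n : ℕ) : ZMod s) * ((c : ZMod s))⁻¹)
              else 0)‖ :=
          sum_sum_le_dilate (g := fun q r' => ‖∑ s ∈ sRange c q r' Slo (2 * Slo), ∑ m ∈ BFI.dyadic M,
            ∑ n ∈ BFI.dyadic N, (if m * n ∈ classFilter c q w r' Y then
              ((α m : ℝ) : ℂ) * ((β n : ℝ) : ℂ) * uR (x ^ (40 * ρ)) s (((m * n : ℕ) : ZMod s) * ((c : ZMod s))⁻¹)
              else 0)‖) (fun _ _ => norm_nonneg _) hx1 (by linarith) hP hR0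
      _ = ∑ q ∈ Icc 1 ⌊x ^ (4 * ρ)⌋₊, ∑ r' ∈ Icc 1 ⌊R * P⌋₊,
          ‖∑ s ∈ sRange c q r' Slo (2 * Slo), ∑ m ∈ BFI.dyadic M, ∑ n ∈ BFI.dyadic N,
            (if (0 : ℝ) < ((m * n : ℕ) : ℝ) ∧ ((m * n : ℕ) : ℝ) ≤ Y ∧
                ((m * n : ℕ) : ZMod r') = (((fun _ => c) r' : ℤ) : ZMod r') ∧
                ((m * n : ℕ) : ZMod q) = (((fun _ => (w : ℤ) + c) q : ℤ) : ZMod q) then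
              ((α m : ℝ) : ℂ) * ((β n : ℝ) : ℂ) * uR (x ^ (40 * ρ)) s (((m * n : ℕ) : ZMod s) * ((c : ZMod s))⁻¹)
              else 0)‖ := by
          refine Finset.sum_congr rfl fun q _ => Finset.sum_congr rfl fun r' _ => ?_
          congr 1
          exact Finset.sum_congr rfl fun s hs => Finset.sum_congr rfl fun m _ =>
            Finset.sum_congr rfl fun n _ => hsummand q r' s hs m n
      _ ≤ C * x ^ (1 + 5 * (4 * ρ)) / x ^ (40 * ρ) := key
      _ ≤ max C 0 * x ^ (1 + 5 * (4 * ρ)) / x ^ (40 * ρ) := by gcongr; exact le_max_left _ _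
      _ = max C 0 * x ^ (1 - 20 * ρ) := by
          rw [mul_div_assoc, ← Real.rpow_sub hx0]; ring_nf
  -- add up the `≤ 16` pairs
  have hab : (Sᶜ.card : ℝ) * S.card ≤ 16 := by
    have h1 : (Sᶜ.card : ℝ) + S.card ≤ 8 := by exact_mod_cast (show Sᶜ.card + S.card ≤ 8 by omega)
    nlinarith [sq_nonneg ((Sᶜ.card : ℝ) - S.card)]
  calc _ ≤ ∑ _i ∈ Finset.range Sᶜ.card, ∑ _i' ∈ Finset.range S.card, max C 0 * x ^ (1 - 20 * ρ) :=
        Finset.sum_le_sum fun i hi => Finset.sum_le_sum fun i' hi' => hpair i hi i' hi'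
    _ = (Sᶜ.card : ℝ) * S.card * (max C 0 * x ^ (1 - 20 * ρ)) := by
        rw [Finset.sum_const, Finset.sum_const, Finset.card_range, Finset.card_range, smul_smul, nsmul_eq_mul]
        push_cast; ring
    _ ≤ 16 * (max C 0 * x ^ (1 - 20 * ρ)) := by gcongr
    _ = (16 * max C 0) * x ^ (1 - 20 * ρ) := by ring
    _ ≤ x ^ (14 * ρ) * x ^ (1 - 20 * ρ) := mul_le_mul_of_nonneg_right e1 (Real.rpow_nonneg hx0.le _)
    _ = x ^ (1 - 6 * ρ) := by rw [← Real.rpow_add hx0]; ring_nf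

/-- Landing anchor of the `𝔲_R`-bound chain, file 5; registered stub `urbChain5_anchor` of the crux item (the
mathematical content of this file is `urb_typeII`). -/
theorem urbChain5_anchor : True := trivial

end Summit.Parity.GeneralizedHardyLittlewood.Cruxes.TypeI2Dilated.PeelToDrappeau

end
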